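import Summits.CriticalPhenomena.PercolationContinuityZ3.Theorems.FreeBoxSparse.Negative.OfContinuity
import Summits.CriticalPhenomena.PercolationContinuityZ3.Theorems.FreeBoxSparse.Negative.DCTFloor
import Literature.Barriers.CriticalPhenomena.LaceExpansionHighDimensionOneArm

/-!
# `FreeBoxSparse` (crux stmt-CriticalPhenomena-4445): the upper sandwich `FA₂(p, n) ≤ θ(p)² + o(1)`

Negative-side analysis (cdisprove, refuter-cdisprove-stmt-CriticalPhenomena-4445-0), all PROVED, for
`FA₂(p, n) := |B(n)|⁻² Σ_{x,y∈B(n)} P_p(x ↔ y in B(n))` (the crux is `FA₂(p_c, n) → 0`):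

(Uses `tendsto_pairAverage_of_tendsto_cofinite` of `OfContinuity.lean` and `card_box_pos` of
`DCTFloor.lean`.)

* `tendsto_tau_sub_theta_sq` — **`τ_p(0, v) → θ(p)²` as `v → ∞`, at every `p`** (lower bound
  `θ² ≤ τ` by uniqueness + Harris–FKG, tree: `Grimmett1999_theta_sq_le_openConn_holds`; upper
  bound `τ_p(0,v) ≤ π_p(n)²` for `v ∉ B(2n)` by two disjoint boxes, tree:
  `tau_le_oneArmProb_sq_of_coord`, and `π_p(n) ↓ θ(p)`, tree:
  `DCT16.le_theta_of_forall_le_real_siteToBoundary`);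
* `tendsto_bulkPairAverage` — the BULK pair average `|B(n)|⁻² Σ_{x,y∈B(n)} τ_p(x,y) → θ(p)²`;
* `eventually_freePairAverage_le` — **`FA₂(p, n) ≤ θ(p)² + ε` eventually**, every `p`, `ε > 0`.

Reading for the crux: with the route's `SpanningPiecesCount` (`FA₂ ≳ θ²/N_n` on `{N_n ≤ M}` in a
jump world) the quantity is sandwiched, `θ(p_c)²/N_n ≲ FA₂(p_c, n) ≲ θ(p_c)²`; `¬ FreeBoxSparse`
means exactly a jump `θ(p_c) > 0` together with a non-vanishing in-box gluing fraction
`limsup FA₂(p_c, n)/θ(p_c)² ∈ (0, 1]`.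
-/

namespace Summit.CriticalPhenomena.PercolationContinuityZ3.Theorems.FreeBoxSparse.Negative

open MeasureTheory Filter Topology
open Literature.Probability.Percolation Literature.Probability.LatticeModels
open Literature.Barriers.CriticalPhenomena (tau_le_oneArmProb_sq_of_coord oneArmProb_mem_Icc)

/-- The one-arm probabilities get within `ε` of `θ(p)` (they decrease to it). [folklore] -/
theorem exists_oneArmProb_lt (p : unitInterval) {ε : ℝ} (hε : 0 < ε) :
    ∃ n : ℕ, oneArmProb 3 p n < theta (zdGraph 3) 0 p + ε := by
  by_contra h
  push Not at h
  have := DCT16.le_theta_of_forall_le_real_siteToBoundary (d := 3) p h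
  linarith

/-- Two disjoint boxes: `τ_p(0, v) ≤ π_p(n)²` for `v ∉ B(2n)`. [folklore] -/
theorem tau_le_oneArmProb_sq {n : ℕ} {v : Site 3} (hv : v ∉ box 3 (2 * n)) (p : unitInterval) :
    tau 3 p 0 v ≤ oneArmProb 3 p n ^ 2 := by
  rw [mem_box] at hv
  push Not at hv
  obtain ⟨i, hi⟩ := hv
  refine tau_le_oneArmProb_sq_of_coord n p i (le_abs'.2 ?_)
  by_cases h : -((2 * n : ℕ) : ℤ) ≤ v i
  · have := hi h; push_cast at this ⊢; omega
  · push_cast at h ⊢; omega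

/-- **`τ_p(0, v) → θ(p)²` as `v → ∞`** (every `p`): `0 ≤ τ_p(0,v) - θ(p)² → 0` cofinitely.
[folklore] -/
theorem tendsto_tau_sub_theta_sq (p : unitInterval) :
    Tendsto (fun v : Site 3 => tau 3 p 0 v - theta (zdGraph 3) 0 p ^ 2) cofinite (𝓝 0) := by
  rw [Metric.tendsto_nhds]
  intro ε hε
  set θ := theta (zdGraph 3) 0 p with hθ
  have hθ0 : 0 ≤ θ := measureReal_nonneg
  have hθ1 : θ ≤ 1 := measureReal_le_one
  have hδ : 0 < min (ε / 4) 1 := lt_min (by linarith) one_pos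
  obtain ⟨n, hn⟩ := exists_oneArmProb_lt p hδ
  have hπ0 : 0 ≤ oneArmProb 3 p n := (oneArmProb_mem_Icc 3 p n).1
  refine Filter.eventually_cofinite.2 ((box 3 (2 * n)).finite_toSet.subset fun v hv => ?_)
  by_contra hvb
  apply hv
  have hlow : θ ^ 2 ≤ tau 3 p 0 v := Grimmett1999_theta_sq_le_openConn_holds 3 p 0 v
  have hup : tau 3 p 0 v ≤ oneArmProb 3 p n ^ 2 := tau_le_oneArmProb_sq (fun h => hvb h) p
  rw [Real.dist_eq, sub_zero, abs_of_nonneg (by linarith)]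
  have h1 : oneArmProb 3 p n < θ + min (ε / 4) 1 := hn
  have hm1 : min (ε / 4) 1 ≤ ε / 4 := min_le_left _ _
  have hm2 : min (ε / 4) 1 ≤ 1 := min_le_right _ _
  nlinarith

/-- **`τ_p(0, v) → θ(p)²`** in the usual form. [folklore] -/
theorem tendsto_tau_theta_sq (p : unitInterval) :
    Tendsto (tau 3 p 0) cofinite (𝓝 (theta (zdGraph 3) 0 p ^ 2)) := by
  have h := (tendsto_tau_sub_theta_sq p).add_const (theta (zdGraph 3) 0 p ^ 2)
  simpa using h

/-- **The bulk pair average tends to `θ(p)²`** (every `p`). [folklore] -/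
theorem tendsto_bulkPairAverage (p : unitInterval) :
    Tendsto (fun n : ℕ => (∑ x ∈ box 3 n, ∑ y ∈ box 3 n, tau 3 p x y) / ((box 3 n).card : ℝ) ^ 2)
      atTop (𝓝 (theta (zdGraph 3) 0 p ^ 2)) := by
  set θ := theta (zdGraph 3) 0 p with hθ
  have h := tendsto_pairAverage_of_tendsto_cofinite (tendsto_tau_sub_theta_sq p)
    (g := fun _ x y => tau 3 p x y - θ ^ 2)
    (fun _ x y => sub_nonneg.2 (Grimmett1999_theta_sq_le_openConn_holds 3 p x y))
    (fun _ x y => by linarith [tau_le_one p x y, sq_nonneg θ])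
    (fun _ x y => by rw [tau_eq_tau_zero_sub p x y])
  have heq : ∀ n : ℕ, (∑ x ∈ box 3 n, ∑ y ∈ box 3 n, (tau 3 p x y - θ ^ 2)) / ((box 3 n).card : ℝ) ^ 2
      = (∑ x ∈ box 3 n, ∑ y ∈ box 3 n, tau 3 p x y) / ((box 3 n).card : ℝ) ^ 2 - θ ^ 2 := by
    intro n
    have hc := card_box_pos n
    simp only [Finset.sum_sub_distrib, Finset.sum_const, nsmul_eq_mul]
    field_simp
  have h' : Tendsto (fun n : ℕ => (∑ x ∈ box 3 n, ∑ y ∈ box 3 n, tau 3 p x y) /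
      ((box 3 n).card : ℝ) ^ 2 - θ ^ 2) atTop (𝓝 0) := h.congr heq
  have h'' := h'.add_const (θ ^ 2)
  simpa using h''

/-- Free ≤ bulk: `FA₂(p, n)` is at most the bulk pair average. [folklore] -/
theorem freePairAverage_le_bulkPairAverage (p : unitInterval) (n : ℕ) :
    (∑ x ∈ box 3 n, ∑ y ∈ box 3 n, (bondPercolation (zdGraph 3) p).real
        (openConnIn (↑(box 3 n) : Set (Site 3)) x y)) / ((box 3 n).card : ℝ) ^ 2 ≤
      (∑ x ∈ box 3 n, ∑ y ∈ box 3 n, tau 3 p x y) / ((box 3 n).card : ℝ) ^ 2 :=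
  div_le_div_of_nonneg_right
    (Finset.sum_le_sum fun x _ => Finset.sum_le_sum fun y _ => by
      rw [tau_def]
      exact measureReal_mono fun ω hω => DCT16.reachable_of_pathIn (DCT16.pathIn_of_mem_openConnIn hω))
    (sq_nonneg _)

/-- **The upper sandwich**: for every `p` and `ε > 0`, eventually `FA₂(p, n) ≤ θ(p)² + ε`.
[folklore] -/
theorem eventually_freePairAverage_le (p : unitInterval) {ε : ℝ} (hε : 0 < ε) :
    ∀ᶠ n : ℕ in atTop,
      (∑ x ∈ box 3 n, ∑ y ∈ box 3 n, (bondPercolation (zdGraph 3) p).real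
          (openConnIn (↑(box 3 n) : Set (Site 3)) x y)) / ((box 3 n).card : ℝ) ^ 2 ≤
        theta (zdGraph 3) 0 p ^ 2 + ε := by
  have h := (tendsto_bulkPairAverage p).eventually
    (Iio_mem_nhds (lt_add_of_pos_right (theta (zdGraph 3) 0 p ^ 2) hε))
  filter_upwards [h] with n hn using (freePairAverage_le_bulkPairAverage p n).trans hn.le

/-- At `p_c`: eventually `FA₂(p_c, n) ≤ θ(p_c)² + ε` — so `¬ FreeBoxSparse` needs a jump AND a
positive in-box gluing fraction. [folklore] -/
theorem eventually_freePairAverage_criticalProbI_le {ε : ℝ} (hε : 0 < ε) :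
    ∀ᶠ n : ℕ in atTop,
      (∑ x ∈ box 3 n, ∑ y ∈ box 3 n, (bondPercolation (zdGraph 3) (criticalProbI 3)).real
          (openConnIn (↑(box 3 n) : Set (Site 3)) x y)) / ((box 3 n).card : ℝ) ^ 2 ≤
        theta (zdGraph 3) 0 (criticalProbI 3) ^ 2 + ε :=
  eventually_freePairAverage_le (criticalProbI 3) hε

end Summit.CriticalPhenomena.PercolationContinuityZ3.Theorems.FreeBoxSparse.Negative
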